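import Literature.NumberTheory.NumberFields.NarrowClassNumberPExtensionOnePrime
import Literature.NumberTheory.IwasawaTheory.ClassicalMuInvariantOnePrimeProofs
import Literature.NumberTheory.IwasawaTheory.ClassicalMuVanishesQuadraticAscentNarrowRat
import Literature.NumberTheory.NumberFields.UnitSignatureSurjective
import Literature.NumberTheory.NumberFields.HasseUnitIndexOddNarrowClassNumber
import HarnessLib

/-!
# NARROW class-number triviality up a `ℤ_p`-tower with one prime above `p` (the narrow form of Iwasawa 1956 / Washington Prop. 13.22):
# `p ∤ h⁺(K)` and ONE prime of `K` above `p` ⟹ `p ∤ h⁺(K_n)` for every layer of EVERY `ℤ_p`-extension; at `p = 2`, units of every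
# signature in every layer; and the resulting `δ = 0` instance of the Kida-lite ascent (proved; no definition, no named fact)

Topic `NumberTheory/IwasawaTheory` (namespace = path).  THEOREM-ONLY file, written by the prover seat `cruxlead-stmt-BirchSwinnertonDyer-19573-w2`
GEN 8 (cell `bsd-2adic`; `--supports` stmt-BirchSwinnertonDyer-19573; closes nothing).  Narrow twin of `ClassicalMuInvariantOnePrimeProofs.lean`
(`iwasawa1956_classNumberPExp_eq_zero_of_not_dvd_classNumber_of_unique_prime_holds`: `p ∤ h(K)`, one prime ⟹ `p ∤ h(K_n)`), obtained from
the NARROW Washington 10.4 (`NarrowClassNumberPExtensionOnePrime.lean`) exactly as the wide one is obtained from Washington 10.4: `K_n/K` is a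
Galois `p`-extension (`isPGroup_aut_layer`) unramified at every prime not above the unique prime `v₀` over `p`
(`isUnramifiedAt_layer_of_natCast_not_mem_under`) — and the narrow statement needs nothing at the infinite places.

* §1 **`not_dvd_narrowClassNumber_layer_of_unique_prime`** — `K` a number field, `p ∤ h⁺(K)`, exactly one prime of `𝓞 K` above `p`, `κ` ANY
  `ℤ_p`-extension of `K`: `p ∤ h⁺(K_n)` for all `n`.  (At `K = ℚ`, `p = 2`: Weber's «`h⁺(ℚ(ζ_{2^{n+2}})⁺)` is odd», conv-1's
  `odd_classNumber_and_forall_isSquare_layer_two`, now for any base.)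
* §2 (`p = 2`, `K` totally real) `isTotallyReal_layer` (layers of a `ℤ_p`-extension of a totally real field are totally real),
  **`odd_narrowClassNumber_layer_two`**, `odd_classNumber_layer_two`, `forall_isSquare_layer_two`, `signVec_surjective_layer_two` (units of EVERY
  signature in every layer `K_n`), `padicValNat_two_narrowClassNumber_layer_eq` (`ord₂ h⁺(K_n) = ord₂ h(K_n) = 0`: the narrow defect of the
  Kida-lite ascent vanishes identically) — from «`h(K)` odd, every totally positive unit of `K` a square (⟺ `h⁺(K)` odd), one prime above `2`».
* §3 **`classicalMu_of_sq_eq_of_odd_of_forall_isSquare_of_unique_prime`** — `K` totally real of ODD degree with one prime above `2`, `h(K)` odd,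
  totally positive units squares; `K' = K(x)` totally complex with `x² = m ∈ 𝓞_K ∖ 0`: EVERY cyclotomic `ℤ₂`-extension of `K'` has `μ = 0`
  (Kida-lite `classicalMu_of_sq_eq_of_odd_finrank_of_narrowClassNumber_eq` with (a) from Iwasawa 1956 kernel and (b) from §2).  For `m = −1`
  and `K` cubic this is the reach of k4-w2's `…GenusDoorSignature` (there via `h(K(√−1))` odd); here ANY `m` (several ramified primes allowed).

HONEST SCOPE.  Classical statements; nothing specific to any summit.  BSD is not proved by any of this.

References: [Washington1997] Thm. 10.4, §13.1 Prop. 13.2, Prop. 13.22; [Greenberg2001IwasawaPastPresent] Prop. 2.1; [GreenbergLNM1716] §5 p. 122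
(`L*_∞ = ℚ_∞`); [FrohlichTaylor1990] Ch. V §1 (1.12); [Iwasawa1973MuInvariants] Thm. 2/3; [Kida1982JFields] (shape).
-/

set_option autoImplicit false

noncomputable section

open scoped NumberField
open NumberField IsDedekindDomain Field

namespace Literature.NumberTheory.IwasawaTheory

open Literature.NumberTheory.EllipticCurves Literature.NumberTheory.EllipticCurves.ZpExtension
  Literature.NumberTheory.NumberFields Literature.Geometry.Kaehler.ComplexTorus

/-! ## §1 `p ∤ h⁺(K)` and one prime above `p` ⟹ `p ∤ h⁺(K_n)` along every `ℤ_p`-extension -/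

section AnyPrime

variable {K : Type} [Field K] [NumberField K] {p : ℕ} [Fact p.Prime]

/-- **Narrow class-number triviality up a `ℤ_p`-tower with one prime above `p`.** For a number field `K`, a prime `p ∤ h⁺(K)` above which
`𝓞 K` has exactly one prime, and ANY `ℤ_p`-extension `κ` of `K`: `p ∤ h⁺(K_n)` for every layer `K_n`.  Proof: the narrow Washington 10.4
(`dvd_narrowClassNumber_of_isPGroup_of_dvd_narrowClassNumber`) applied to the Galois `p`-extension `K_n/K` (`isPGroup_aut_layer`), unramified at
every prime not above the unique prime `v₀` over `p` (`isUnramifiedAt_layer_of_natCast_not_mem_under`); no condition at infinity is needed.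
[cite: Washington1997, Thm. 10.4 and Prop. 13.22] [cite: Greenberg2001IwasawaPastPresent, Prop. 2.1 p. 339] [cite: GreenbergLNM1716, §5, proof of Prop. 5.14 (p. 122)] -/
theorem not_dvd_narrowClassNumber_layer_of_unique_prime (hK : ¬ p ∣ narrowClassNumber K)
    (hv : ∃! v : HeightOneSpectrum (𝓞 K), ((p : ℕ) : 𝓞 K) ∈ v.asIdeal) (κ : ZpExtension K p) (n : ℕ) :
    (haveI : FiniteDimensional K ↥(κ.layer n) := κ.finiteDimensional_layer_holds n
     haveI : NumberField ↥(κ.layer n) := NumberField.of_module_finite K _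
     ¬ p ∣ narrowClassNumber ↥(κ.layer n)) := by
  obtain ⟨v₀, -, huniq⟩ := hv
  haveI : FiniteDimensional K (κ.layer n) := κ.finiteDimensional_layer_holds n
  haveI : IsGalois K (κ.layer n) := κ.isGalois_layer_holds n
  haveI : NumberField (κ.layer n) := NumberField.of_module_finite K (κ.layer n)
  refine not_dvd_narrowClassNumber_of_isPGroup K (κ.layer n) (κ.isPGroup_aut_layer n) v₀ (fun P _ hne => ?_) hK
  refine κ.isUnramifiedAt_layer_of_natCast_not_mem_under n P fun hmem => hne ?_
  -- the contraction of `P` is a non-zero prime containing `p`, hence it is `v₀`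
  have hP0 : P ≠ ⊥ :=
    Ring.ne_bot_of_isMaximal_of_not_isField ‹_› (RingOfIntegers.not_isField (κ.layer n))
  have h0 : P.under (𝓞 K) ≠ ⊥ := mt Ideal.eq_bot_of_comap_eq_bot hP0
  haveI : (P.under (𝓞 K)).IsMaximal := Ideal.IsMaximal.under (𝓞 K) P
  have hw := huniq ⟨P.under (𝓞 K), Ideal.IsMaximal.isPrime ‹_›, h0⟩ hmem
  exact congrArg HeightOneSpectrum.asIdeal hw

/-- **The layers of a `ℤ_p`-extension of a totally real field are totally real** (any `p`): every layer is unramified at the infinite places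
(`ZpExtension.isUnramifiedAtInfinitePlaces_layer`: complex conjugations lie in `ker κ`), and the base has no complex place.
[cite: Washington1997, §13.1 Prop. 13.2] -/
theorem isTotallyReal_layer [IsTotallyReal K] (κ : ZpExtension K p) (n : ℕ) : IsTotallyReal ↥(κ.layer n) := by
  have hunr := κ.isUnramifiedAtInfinitePlaces_layer n
  refine ⟨fun w => ?_⟩
  rcases (InfinitePlace.isUnramified_iff.mp (hunr.isUnramified w)) with h | h
  · exact h
  · exact absurd h (InfinitePlace.not_isComplex_iff_isReal.mpr (IsTotallyReal.isReal _))

end AnyPrime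

/-! ## §2 `p = 2`, `K` totally real: odd narrow class numbers and units of every signature in every layer -/

section Two

variable {K : Type} [Field K] [NumberField K] [IsTotallyReal K]
  (hodd : Odd (classNumber K)) (hsq : ∀ u : (𝓞 K)ˣ, (∀ σ : K →+* ℝ, 0 < σ ((u : 𝓞 K) : K)) → IsSquare u)
  (hv : ∃! v : HeightOneSpectrum (𝓞 K), ((2 : ℕ) : 𝓞 K) ∈ v.asIdeal) (κ : ZpExtension K 2) (n : ℕ)
include hodd hsq hv

/-- **`h⁺(K_n)` is odd in every layer** of every `ℤ₂`-extension of a totally real `K` with `h(K)` odd, every totally positive unit a square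
(⟺ `h⁺(K)` odd, tree `odd_narrowClassNumber_of_odd_classNumber_of_forall_isSquare`) and one prime above `2` (§1 at `p = 2`).
[cite: Washington1997, Thm. 10.4 and Prop. 13.22] [cite: FrohlichTaylor1990, Ch. V §1 (1.12), p. 164] -/
theorem odd_narrowClassNumber_layer_two :
    (haveI : FiniteDimensional K ↥(κ.layer n) := κ.finiteDimensional_layer_holds n
     haveI : NumberField ↥(κ.layer n) := NumberField.of_module_finite K _
     Odd (narrowClassNumber ↥(κ.layer n))) := by
  haveI : Fact (Nat.Prime 2) := ⟨Nat.prime_two⟩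
  haveI : FiniteDimensional K (κ.layer n) := κ.finiteDimensional_layer_holds n
  haveI : NumberField (κ.layer n) := NumberField.of_module_finite K (κ.layer n)
  have hK : ¬ 2 ∣ narrowClassNumber K :=
    (UnramifiedHomsOddNarrowClassNumber.odd_narrowClassNumber_of_odd_classNumber_of_forall_isSquare K hodd hsq).not_two_dvd_nat
  exact Nat.odd_iff.mpr (Nat.two_dvd_ne_zero.mp (not_dvd_narrowClassNumber_layer_of_unique_prime hK hv κ n))

/-- `h(K_n)` is odd in every layer (`h ∣ h⁺`). [cite: Washington1997, Prop. 13.22] [cite: FrohlichTaylor1990, Ch. V §1 (1.8), p. 163] -/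
theorem odd_classNumber_layer_two :
    (haveI : FiniteDimensional K ↥(κ.layer n) := κ.finiteDimensional_layer_holds n
     haveI : NumberField ↥(κ.layer n) := NumberField.of_module_finite K _
     Odd (classNumber ↥(κ.layer n))) := by
  haveI : FiniteDimensional K (κ.layer n) := κ.finiteDimensional_layer_holds n
  haveI : NumberField (κ.layer n) := NumberField.of_module_finite K (κ.layer n)
  exact (odd_narrowClassNumber_layer_two hodd hsq hv κ n).of_dvd_nat (classNumber_dvd_narrowClassNumber _)

/-- **Every totally positive unit of every layer `K_n` is the square of a unit** (`h⁺(K_n)` odd, Hasse; tree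
`forall_isSquare_of_totallyPositive_of_odd_narrowClassNumber`). [cite: FrohlichTaylor1990, Ch. V §1 (1.12), p. 164] [cite: Okazaki2000, §3 Lemma 15] -/
theorem forall_isSquare_layer_two :
    (haveI : FiniteDimensional K ↥(κ.layer n) := κ.finiteDimensional_layer_holds n
     haveI : NumberField ↥(κ.layer n) := NumberField.of_module_finite K _
     ∀ u : (𝓞 ↥(κ.layer n))ˣ, (∀ σ : ↥(κ.layer n) →+* ℝ, 0 < σ ((u : 𝓞 ↥(κ.layer n)) : ↥(κ.layer n))) → IsSquare u) := by
  haveI : FiniteDimensional K (κ.layer n) := κ.finiteDimensional_layer_holds n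
  haveI : NumberField (κ.layer n) := NumberField.of_module_finite K (κ.layer n)
  haveI : IsTotallyReal ↥(κ.layer n) := isTotallyReal_layer κ n
  exact forall_isSquare_of_totallyPositive_of_odd_narrowClassNumber ↥(κ.layer n) (odd_narrowClassNumber_layer_two hodd hsq hv κ n)

/-- **Units of EVERY signature in every layer `K_n`**: the unit signature map `signVec` of `K_n` is onto `𝔽₂^{[K_n : ℚ]}` (GEN 7's
`UnitSignature.signVec_surjective_of_forall_isSquare`). For `K = ℚ` this is the Weber input `signVec_surjective_layer_rat_two` of GEN 7's ascent;
here for any totally real base with one prime above `2` and odd `h⁺`. [cite: FrohlichTaylor1990, Ch. V §1 (1.12), p. 164] [cite: Washington1997, Prop. 13.22] -/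
theorem signVec_surjective_layer_two :
    (haveI : FiniteDimensional K ↥(κ.layer n) := κ.finiteDimensional_layer_holds n
     haveI : NumberField ↥(κ.layer n) := NumberField.of_module_finite K _
     Function.Surjective (signVec (K := ↥(κ.layer n)))) := by
  haveI : FiniteDimensional K (κ.layer n) := κ.finiteDimensional_layer_holds n
  haveI : NumberField (κ.layer n) := NumberField.of_module_finite K (κ.layer n)
  haveI : IsTotallyReal ↥(κ.layer n) := isTotallyReal_layer κ n
  exact UnitSignature.signVec_surjective_of_forall_isSquare (forall_isSquare_layer_two hodd hsq hv κ n)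

/-- **The narrow defect vanishes along the tower: `ord₂ h⁺(K_n) = ord₂ h(K_n)` (`= 0`)** — hypothesis (b) of the Kida-lite ascent with `D = 0`.
[cite: FrohlichTaylor1990, Ch. V §1 (1.12), p. 164] [cite: Washington1997, Prop. 13.22] -/
theorem padicValNat_two_narrowClassNumber_layer_eq :
    (haveI : FiniteDimensional K ↥(κ.layer n) := κ.finiteDimensional_layer_holds n
     haveI : NumberField ↥(κ.layer n) := NumberField.of_module_finite K _
     padicValNat 2 (narrowClassNumber ↥(κ.layer n)) = padicValNat 2 (classNumber ↥(κ.layer n))) := by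
  haveI : FiniteDimensional K (κ.layer n) := κ.finiteDimensional_layer_holds n
  haveI : NumberField (κ.layer n) := NumberField.of_module_finite K (κ.layer n)
  rw [padicValNat.eq_zero_of_not_dvd (odd_narrowClassNumber_layer_two hodd hsq hv κ n).not_two_dvd_nat,
    padicValNat.eq_zero_of_not_dvd (odd_classNumber_layer_two hodd hsq hv κ n).not_two_dvd_nat]

end Two

/-! ## §3 The `δ = 0` instance of the Kida-lite ascent: `μ₂ = 0` for `K(√m)` totally complex over a one-prime, `h⁺`-odd, totally real `K` -/

/-- **`μ₂ = 0` for every cyclotomic `ℤ₂`-extension of `K' = K(√m)`** when `K` is TOTALLY REAL of ODD degree with exactly ONE prime above `2`,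
`h(K)` odd and every totally positive unit of `K` a square (⟺ `h⁺(K)` odd), and `K' = K(x)` is totally complex with `x ∈ 𝓞_{K'}`,
`x² = m ∈ 𝓞_K ∖ 0` (ANY such `m`: several primes of `K` may ramify in `K'`). Proof: (a) `μ₂ = 0` for the cyclotomic `ℤ₂`-extensions of `K`
— indeed `ord₂ h(K_n) = 0` for all `n` (Iwasawa 1956, KERNEL `iwasawa1956_…_holds`); (b) `ord₂ h⁺(K_n) = ord₂ h(K_n)` for all `n` (§2); then
Kida-lite `classicalMu_of_sq_eq_of_odd_finrank_of_narrowClassNumber_eq`. [cite: Iwasawa1973MuInvariants, Thm. 2 and Thm. 3, §4]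
[cite: Greenberg2001IwasawaPastPresent, Prop. 2.1 p. 339] [cite: Washington1997, Thm. 10.4, Prop. 13.22, §13.3 Prop. 13.23] [cite: Kida1982JFields, main theorem (μ-part; shape only)] -/
theorem classicalMu_of_sq_eq_of_odd_of_forall_isSquare_of_unique_prime
    (K K' : Type) [Field K] [NumberField K] [IsTotallyReal K] [Field K'] [NumberField K'] [Algebra K K'] [IsTotallyComplex K']
    (hdeg : Odd (Module.finrank ℚ K)) (hodd : Odd (classNumber K))
    (hsq : ∀ u : (𝓞 K)ˣ, (∀ σ : K →+* ℝ, 0 < σ ((u : 𝓞 K) : K)) → IsSquare u)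
    (hv : ∃! v : HeightOneSpectrum (𝓞 K), ((2 : ℕ) : 𝓞 K) ∈ v.asIdeal)
    {x : 𝓞 K'} {m : 𝓞 K} (hm : m ≠ 0) (hx : x ^ 2 = algebraMap (𝓞 K) (𝓞 K') m) (hgen : Algebra.adjoin K {(x : K')} = ⊤) :
    ∀ κF : ZpExtension K' 2, κF.IsCyclotomic → ClassicalMuVanishes κF := by
  haveI : Fact (Nat.Prime 2) := ⟨Nat.prime_two⟩
  have hK2 : ¬ 2 ∣ classNumber K := hodd.not_two_dvd_nat
  refine classicalMu_of_sq_eq_of_odd_finrank_of_narrowClassNumber_eq K K' hdeg hm hx hgen (fun κP _ => ?_) (fun κP _ n => ?_)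
  · exact classicalMuVanishes_of_classNumberPExp_eq_zero
      iwasawa1956_classNumberPExp_eq_zero_of_not_dvd_classNumber_of_unique_prime_holds hK2 hv κP
  · exact padicValNat_two_narrowClassNumber_layer_eq hodd hsq hv κP n

end Literature.NumberTheory.IwasawaTheory

end
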